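import Mathlib

/-!
# Certifier norm bounds, supplement: the rank-one correction of the NESTED tail closure (SKEWCUT-PAIR §9 (N4)) (profile-cert-3 g3, cell `ns-blowup`, 2026-08-26)

HONEST FRAMING (human rulings D-0035/D-0074): nothing here is a claim about Navier–Stokes blow-up.
WHAT THIS IS NOT: not NS evidence. Supplement to `CertifierNormBounds.lean` (same namespace). In the 3-B NESTED
certificate (cap `SKEWCUT-PAIR.md` §9 (N4); cert `PLAN.md` §1; all three implementations, e.g. impl-3 `cert3.py`
`mu_eff = MU2_b0 − ‖ṽ_t‖·‖gB‖`) the border column `ṽ = ṽ_h + ṽ_t` has a tail leftover `ṽ_t`, so the tail Schur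
complement of the bordered operator is `Z = Z₀ − ṽ_t ⊗ φ` with `Z₀ = D − C N_b B` (coercive with the certified constant
`MU2_b,0`) and the bounded functional `φ = g*B(·)_{K₀+1}` (`‖φ‖ ≤ ‖B*g‖`). The sentence «`Re⟨Zw, w⟩ ≥ (MU2_b,0 −
‖B*g‖·‖ṽ_t‖)‖w‖² =: μ_eff‖w‖²`» is the following Cauchy–Schwarz step, stated for any map `Z₀` on an inner product
space whose quadratic form is bounded below and any rank-one perturbation `w ↦ φ(w)•u` with `‖φ w‖ ≤ c‖w‖`:

* `re_inner_sub_rankOne_ge` — `μ‖w‖² ≤ Re⟪w, Z₀w⟫` for all `w` ⇒ `(μ − c‖u‖)‖w‖² ≤ Re⟪w, Z₀w − φ(w)•u⟫` for all `w`.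

Mathlib only; no new definitions. bears_on LADDER-NS N5 / Z4-a(1) (F5 certificate rigour); evidence-only for route item
`EpisodeBase` (stmt-NavierStokesRegularity-19179).
-/

namespace Summit.NavierStokesRegularity.FluidComputer.CertifierNormBounds

section RankOne

variable {𝕜 : Type*} [RCLike 𝕜] {E : Type*} [NormedAddCommGroup E] [InnerProductSpace 𝕜 E]

open RCLike

/-- **Rank-one correction of a coercive form** ((N4) of the nested 3-B tail closure). If `Re⟪w, Z₀ w⟫ ≥ μ‖w‖²` for
every `w`, `u` is a fixed vector and `φ` any scalar-valued map with `‖φ w‖ ≤ c‖w‖`, then the perturbed map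
`w ↦ Z₀ w − φ(w)•u` satisfies `Re⟪w, Z₀ w − φ(w)•u⟫ ≥ (μ − c‖u‖)‖w‖²`. (In the certificate: `u = ṽ_t`,
`φ = g*B(·)_{K₀+1}`, `c = ‖B*g‖`, `μ = MU2_b,0`, conclusion `μ_eff = MU2_b,0 − ‖B*g‖‖ṽ_t‖`.) [folklore] -/
theorem re_inner_sub_rankOne_ge (Z₀ : E → E) (φ : E → 𝕜) (u : E) {μ c : ℝ}
    (hZ : ∀ w : E, μ * ‖w‖ ^ 2 ≤ re (inner 𝕜 w (Z₀ w))) (hφ : ∀ w : E, ‖φ w‖ ≤ c * ‖w‖) (w : E) :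
    (μ - c * ‖u‖) * ‖w‖ ^ 2 ≤ re (inner 𝕜 w (Z₀ w - φ w • u)) := by
  rw [inner_sub_right, map_sub, inner_smul_right]
  have h1 := hZ w
  have h2 : re (φ w * inner 𝕜 w u) ≤ c * ‖u‖ * ‖w‖ ^ 2 := by
    calc re (φ w * inner 𝕜 w u) ≤ ‖φ w * inner 𝕜 w u‖ := re_le_norm _
      _ = ‖φ w‖ * ‖inner 𝕜 w u‖ := norm_mul _ _
      _ ≤ (c * ‖w‖) * (‖w‖ * ‖u‖) :=
          mul_le_mul (hφ w) (norm_inner_le_norm w u) (norm_nonneg _) ((norm_nonneg _).trans (hφ w))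
      _ = c * ‖u‖ * ‖w‖ ^ 2 := by ring
  nlinarith

/-- The same with the functional bounded in operator norm: `φ : E →L[𝕜] 𝕜` with `‖φ‖ ≤ c`. [folklore] -/
theorem re_inner_sub_rankOne_ge_of_opNorm_le (Z₀ : E → E) (φ : E →L[𝕜] 𝕜) (u : E) {μ c : ℝ}
    (hZ : ∀ w : E, μ * ‖w‖ ^ 2 ≤ re (inner 𝕜 w (Z₀ w))) (hφ : ‖φ‖ ≤ c) (w : E) :
    (μ - c * ‖u‖) * ‖w‖ ^ 2 ≤ re (inner 𝕜 w (Z₀ w - φ w • u)) :=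
  re_inner_sub_rankOne_ge Z₀ φ u hZ (fun w => (φ.le_opNorm w).trans (by gcongr)) w

end RankOne

end Summit.NavierStokesRegularity.FluidComputer.CertifierNormBounds
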